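import Mathlib
import Literature.Computability.AlgebraicComplexity.DeterminantalComplexity
import Literature.Computability.AlgebraicComplexity.LRPencilOfMatrix
import Literature.Computability.AlgebraicComplexity.OrbitClosureProofs
import Literature.Computability.AlgebraicComplexity.StandardFamilies
import Summits.ValiantsHypothesis.ValiantsHypothesis.Theses.RefutationDegree

/-!
# Kernel planes of an affine determinantal expression (line `Sketch`, crux `BeyondHessianNs`)

Helper file for crux item stmt-ValiantsHypothesis-5641 (`RefutationDegree.BeyondHessianNs`).

**The kernel-plane lemma.** If a homogeneous polynomial `f` of degree `d` in the variables `σ`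
over an infinite field `K` has an affine determinantal expression `f = det A(x)` of size `m`, then
through EVERY zero `y` of `f` there passes a LINEAR subspace `W ∋ y` of the zero set of `f` with
`dim W ≥ #σ - m`: pick `u ≠ 0` in `ker A(y)`; the affine space `Λ = {x | A(x) u = 0}` contains `y`,
has codimension `≤ m` and lies in `{f = 0}`; by homogeneity `W = K ∙ y + (Λ - y)` works
(the directions `z ∈ Λ - y` themselves are zeros of `f` because `t ↦ f(t • y + z)` vanishes for all
`t ≠ 0`, hence identically, `K` being infinite).

Consequence (`sq_le_add_of_hasDetRepr_perPoly`): `dc(per_n) ≥ n² - 𝔣(y)` for every zero `y` of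
`per_n`, where `𝔣(y)` bounds the dimension of the linear subspaces of `{per_n = 0}` through `y`.
This is the "first lemma" shared by the crux idea cards `kernel-plane-jet-incidence` (ideator 1,
`KernelPlane` / `KernelPlaneHom`) and `fano-span-ns` (ideator 2, `LinearSpanTransfer`).
-/

noncomputable section

-- `Summit.ValiantsHypothesis.ValiantsHypothesis.…` is the tree's mandated single-conjunct layout.
set_option linter.dupNamespace false

namespace Summit.ValiantsHypothesis.ValiantsHypothesis.Theorems.RefutationDegreeBeyondHessianNs

open MvPolynomial Matrix
open Literature.Computability.AlgebraicComplexity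

section General

variable {K : Type*} [Field K] {σ : Type*} [Fintype σ]

/-- The linear part of an affine matrix pencil applied to a fixed vector `u` is the matrix
`(i, w) ↦ (A_w u)_i` acting on the point: `(Σ_w x_w • A_w) u = B x`. [folklore] -/
theorem sum_smul_mulVec_eq {m : ℕ} (M : σ → Matrix (Fin m) (Fin m) K) (u : Fin m → K)
    (x : σ → K) :
    (∑ w, x w • M w) *ᵥ u = (Matrix.of fun i w => (M w *ᵥ u) i) *ᵥ x := by
  ext i
  simp only [Matrix.mulVec, dotProduct, Matrix.of_apply, Matrix.sum_apply,
    Matrix.smul_apply, smul_eq_mul, Finset.sum_mul]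
  rw [Finset.sum_comm]
  refine Finset.sum_congr rfl fun w _ => ?_
  refine Finset.sum_congr rfl fun j _ => ?_
  ring

/-- `A(x) u = A(0) u + B x` for a matrix `A` of affine linear forms, with `B` the matrix
`(i, w) ↦ (A_w u)_i` of the linear part. [folklore] -/
theorem map_eval_mulVec_eq {m : ℕ} (A : Matrix (Fin m) (Fin m) (MvPolynomial σ K))
    (hA : ∀ i j, (A i j).totalDegree ≤ 1) (u : Fin m → K) (x : σ → K) :
    A.map (eval x) *ᵥ u = constPart A *ᵥ u +
      (Matrix.of fun i w => (LRPencil.coeffMat A w *ᵥ u) i) *ᵥ x := by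
  rw [LRPencil.map_eval_eq A hA x, Matrix.add_mulVec, sum_smul_mulVec_eq]

omit [Fintype σ] in
/-- A univariate restriction: `t ↦ f(t • y + z)` as a polynomial in `t`. [folklore] -/
theorem eval_aeval_line (f : MvPolynomial σ K) (y z : σ → K) (t : K) :
    Polynomial.eval t (aeval (fun e => Polynomial.C (y e) * Polynomial.X + Polynomial.C (z e)) f)
      = eval (t • y + z) f := by
  rw [← Polynomial.coe_aeval_eq_eval, comp_aeval_apply]
  have hfun : (fun e => (Polynomial.aeval t) (Polynomial.C (y e) * Polynomial.X + Polynomial.C (z e)))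
      = t • y + z := by
    funext e
    simp only [map_add, map_mul, Polynomial.aeval_C, Polynomial.aeval_X, Pi.add_apply,
      Pi.smul_apply, smul_eq_mul, Algebra.algebraMap_self, RingHom.id_apply]
    ring
  rw [hfun, aeval_eq_eval]

/-- **Kernel-plane lemma** (general form). Let `f` be homogeneous of degree `d` over an infinite
field, with an affine determinantal expression `A` of size `m`, and let `y` be a zero of `f`.
Then some linear subspace `W ∋ y` of dimension `≥ #σ - m` lies in the zero set of `f`.
[folklore] -/
theorem exists_submodule_of_isAffineDetRepr [Infinite K] {f : MvPolynomial σ K} {d m : ℕ}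
    (hf : f.IsHomogeneous d) {A : Matrix (Fin m) (Fin m) (MvPolynomial σ K)}
    (hA : IsAffineDetRepr f A) (y : σ → K) (hy : eval y f = 0) :
    ∃ W : Submodule K (σ → K), y ∈ W ∧ Fintype.card σ ≤ Module.finrank K W + m ∧
      ∀ w ∈ W, eval w f = 0 := by
  classical
  obtain ⟨hdeg, hdet⟩ := hA
  -- evaluation of `det A` at a point is the determinant of the evaluated matrix
  have heval : ∀ x : σ → K, eval x f = (A.map (eval x)).det := fun x => by
    rw [← hdet, RingHom.map_det, RingHom.mapMatrix_apply]
  -- `A(y)` is singular: pick a kernel vector `u ≠ 0`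
  have hsing : (A.map (eval y)).det = 0 := by rw [← heval, hy]
  obtain ⟨u, hu0, hu⟩ := Matrix.exists_mulVec_eq_zero_iff.mpr hsing
  set Φ : (σ → K) →ₗ[K] (Fin m → K) :=
    Matrix.mulVecLin (Matrix.of fun i w => (LRPencil.coeffMat A w *ᵥ u) i) with hΦ
  have hΦapply : ∀ x, Φ x = (Matrix.of fun i w => (LRPencil.coeffMat A w *ᵥ u) i) *ᵥ x :=
    fun x => rfl
  -- points `x` with `x - y ∈ ker Φ` are zeros of `f`
  have hker : ∀ x : σ → K, Φ (x - y) = 0 → eval x f = 0 := by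
    intro x hx
    have h1 : A.map (eval x) *ᵥ u = 0 := by
      have hy' := map_eval_mulVec_eq A hdeg u y
      rw [hu, ← hΦapply] at hy'
      rw [map_eval_mulVec_eq A hdeg u x, ← hΦapply, map_sub, sub_eq_zero] at *
      rw [hx, ← hy']
    rw [heval]
    exact Matrix.exists_mulVec_eq_zero_iff.mp ⟨u, hu0, h1⟩
  refine ⟨(K ∙ y) ⊔ LinearMap.ker Φ, Submodule.mem_sup_left (Submodule.mem_span_singleton_self y),
    ?_, ?_⟩
  · -- dimension count: `#σ = rank Φ + null Φ ≤ m + dim W`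
    have h1 := LinearMap.finrank_range_add_finrank_ker Φ
    have h2 : Module.finrank K (LinearMap.range Φ) ≤ m := by
      calc Module.finrank K (LinearMap.range Φ) ≤ Module.finrank K (Fin m → K) :=
            Submodule.finrank_le _
        _ = m := by simp
    have h3 : Module.finrank K (LinearMap.ker Φ) ≤
        Module.finrank K ↥((K ∙ y) ⊔ LinearMap.ker Φ) :=
      Submodule.finrank_mono le_sup_right
    have h4 : Module.finrank K (σ → K) = Fintype.card σ := by simp
    omega
  · -- zeros: `w = a • y + z` with `z ∈ ker Φ`
    intro w hw
    obtain ⟨y', hy', z, hz, rfl⟩ := Submodule.mem_sup.mp hw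
    obtain ⟨a, rfl⟩ := Submodule.mem_span_singleton.mp hy'
    rw [LinearMap.mem_ker] at hz
    -- for `a ≠ 0`, `f(a • y + z) = a^d f(y + a⁻¹ • z) = 0`
    have hne : ∀ a : K, a ≠ 0 → eval (a • y + z) f = 0 := by
      intro a ha
      have hx : a • y + z = a • (y + a⁻¹ • z) := by
        rw [smul_add, smul_smul, mul_inv_cancel₀ ha, one_smul]
      rw [hx, eval_smul_of_isHomogeneous hf, hker, mul_zero]
      rw [add_sub_cancel_left, map_smul, hz, smul_zero]
    by_cases ha : a = 0
    · -- the polynomial `t ↦ f(t • y + z)` has infinitely many roots, hence vanishes at `t = 0`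
      subst ha
      set G := aeval (fun e => Polynomial.C (y e) * Polynomial.X + Polynomial.C (z e)) f with hG
      have hG0 : G = 0 := by
        apply Polynomial.eq_zero_of_infinite_isRoot
        refine Set.Infinite.mono (s := {t : K | t ≠ 0}) ?_ ?_
        · intro t ht
          simp only [Set.mem_setOf_eq, Polynomial.IsRoot.def]
          rw [hG, eval_aeval_line, hne t ht]
        · have : ({t : K | t ≠ 0}) = ({0} : Set K)ᶜ := by ext; simp
          rw [this]
          exact (Set.finite_singleton (0 : K)).infinite_compl
      have := eval_aeval_line f y z 0
      rw [← hG, hG0, Polynomial.eval_zero] at this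
      rw [← this]
    · exact hne a ha

/-- **Kernel-plane lemma**, `HasDetRepr` form: `#σ ≤ dim W + m` for some linear subspace `W ∋ y`
of the zero set through any zero `y`. [folklore] -/
theorem exists_submodule_of_hasDetRepr [Infinite K] {f : MvPolynomial σ K} {d m : ℕ}
    (hf : f.IsHomogeneous d) (h : HasDetRepr f m) (y : σ → K) (hy : eval y f = 0) :
    ∃ W : Submodule K (σ → K), y ∈ W ∧ Fintype.card σ ≤ Module.finrank K W + m ∧
      ∀ w ∈ W, eval w f = 0 := by
  obtain ⟨A, hA⟩ := h
  exact exists_submodule_of_isAffineDetRepr hf hA y hy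

end General

/-! ### The permanent -/

/-- **Kernel planes for the permanent** (card `kernel-plane-jet-incidence`, `KernelPlane`): a
size-`m` affine determinantal expression of `per_n` over `ℂ` puts through every zero `y` of
`per_n` a linear subspace of `{per_n = 0}` of dimension `≥ n² - m`. [folklore] -/
theorem kernelPlane_perPoly (n m : ℕ) (h : HasDetRepr (perPoly (Fin n) ℂ) m)
    (y : Fin n × Fin n → ℂ) (hy : eval y (perPoly (Fin n) ℂ) = 0) :
    ∃ W : Submodule ℂ (Fin n × Fin n → ℂ), y ∈ W ∧ n ^ 2 ≤ Module.finrank ℂ W + m ∧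
      ∀ w ∈ W, eval w (perPoly (Fin n) ℂ) = 0 := by
  have hhom : (perPoly (Fin n) ℂ).IsHomogeneous n := by
    simpa [Fintype.card_fin] using (perPoly_isHomogeneous (n := Fin n) (k := ℂ))
  obtain ⟨W, hyW, hcard, hzero⟩ := exists_submodule_of_hasDetRepr hhom h y hy
  refine ⟨W, hyW, ?_, hzero⟩
  simpa [Fintype.card_prod, Fintype.card_fin, sq] using hcard

/-- **Linear-span transfer** (card `fano-span-ns`, `LinearSpanTransfer`): if every linear subspace
of `{per_n = 0}` through the zero `x₀` has dimension `≤ d`, then `n² ≤ m + d` for every size `m` of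
an affine determinantal expression of `per_n`, i.e. `dc(per_n) ≥ n² - 𝔣(x₀)`. [folklore] -/
theorem sq_le_add_of_hasDetRepr_perPoly (n m d : ℕ) (x₀ : Fin n × Fin n → ℂ)
    (hx₀ : eval x₀ (perPoly (Fin n) ℂ) = 0)
    (hd : ∀ W : Submodule ℂ (Fin n × Fin n → ℂ), x₀ ∈ W →
      (∀ w ∈ W, eval w (perPoly (Fin n) ℂ) = 0) → Module.finrank ℂ W ≤ d)
    (h : HasDetRepr (perPoly (Fin n) ℂ) m) : n ^ 2 ≤ m + d := by
  obtain ⟨W, hW, hcard, hzero⟩ := kernelPlane_perPoly n m h x₀ hx₀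
  have := hd W hW hzero
  omega

end Summit.ValiantsHypothesis.ValiantsHypothesis.Theorems.RefutationDegreeBeyondHessianNs

end
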